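import Mathlib
import Summits.MatrixMultiplication.MatrixMultiplication.Theses.GelfandPairHosts

/-!
# `GelfandHosting` (crux stmt-MatrixMultiplication-7381): calibration of `stub_saturatedTripleHosts`
# by the Cohn–Kleinberg–Szegedy–Umans wreath-product triple over `𝔽₂⁴`

Negative-side calibration file of the line lead (2026-08-17); `sorry`-free.  It pins down WHERE the
content of the open stub `stub_saturatedTripleHosts` (generously transitive host + stabiliser-saturated
TPP triple with `D ≤ (|S||T||U•x₀|)^{(2+ε)/3}`) starts: its `∃`-body holds verbatim for every
`ε ≥ 11/12` (`wreathF2_stubBody_of_ge`), and a module host "beats the sum of the squares"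
(`wreathF2_beats`, the `∃`-shape feeding `BeatTheSquares` through stubs 1–2).

Construction (Cohn–Kleinberg–Szegedy–Umans 2005, §2 / Lemma 2.1, with `ℤₙ` replaced by the elementary
abelian group `V = 𝔽₂⁴` so that the host is generously transitive): `H = V³` (coordinates `0,1,2`),
`E = H × H`, `G = E ⋊ C₂ = H ≀ C₂` (`wreathF2G`, the flag `f : ZMod 2` swapping the two copies of `H`),
acting on `X = E` by `(t,f) • x = t + f·x` (affine, so `g • x = y ∧ g • y = x` for `g = (x + y, 0)`:
characteristic two).  The three sets are `S = m₀(V∖0 × V × C₂)`, `T = m₁(…)`, `U = m₂(…)` with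
`mᵢ(a,b,f) = ((aeᵢ, beᵢ₊₁), f)`, each of size `15·16·2 = 480`; `U` is saturated by the stabiliser
`C₂` of `x₀ = 0` and `|U • x₀| = 240`, so `|S||T||U•x₀| = 55296000 = 2^{25.72…}` while
`D = dim span{P_g} ≤ |G| = 2²⁵ = 33554432` (`finrank_range_le_card`).  The triple product property
(`wreathF2_tpp`) is the CKSU parity argument: writing the quotients as `(eᵢ + φᵢ·eᵢ', φᵢ)`, the
flag of `s s'⁻¹ t t'⁻¹ u u'⁻¹` forces `φ₁ + φ₂ + φ₃ = 0` (an even number of swaps); with no swap the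
three coordinates separate the legs, with two swaps a non-zero `aᵢ` is isolated in one coordinate —
done here by exhausting the `2³` patterns `(φ₁, φ₂, φ₃)` with `simp`.
Numerics: `2²⁵ ≤ 55296000^{35/36}` (as `33554432³⁶ ≤ 55296000³⁵`) and `(2+ε)/3 ≥ 35/36` for
`ε ≥ 11/12`.  `wreathF2_saturatedTriple` packages the host with the exact capacity `55296000` and
`|G| = 33554432`; the two calibration theorems are corollaries via `finrank_range_le_card`.
NOT here: any claim for `ε < 11/12` (the stub itself is expected to be false).
-/

set_option linter.dupNamespace false

namespace Summit.MatrixMultiplication.MatrixMultiplication.Theorems.GelfandHosting.Negative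

/-! ### The base group `E = H × H`, `H = V³`, `V = 𝔽₂⁴`, and the swap action of `C₂` -/

/-- `V = 𝔽₂⁴`, realised as `Fin 4 → ZMod 2`. -/
abbrev wreathF2V : Type := Fin 4 → ZMod 2

/-- `H = V³ = H₀ × H₁ × H₂`, realised as `Fin 3 → V`. -/
abbrev wreathF2H : Type := Fin 3 → wreathF2V

/-- `E = H × H`, the elementary abelian base group of the wreath product (`2²⁴` elements). -/
abbrev wreathF2E : Type := wreathF2H × wreathF2H

/-- `1 + 1 = 0` in `ZMod 2`. [folklore] -/
@[simp] theorem wreathF2_one_add_one : (1 : ZMod 2) + 1 = 0 := by decide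

/-- Every element of `ZMod 2` is `0` or `1`. [folklore] -/
theorem wreathF2_zmod2 : ∀ f : ZMod 2, f = 0 ∨ f = 1 := by decide

/-- In `V = 𝔽₂⁴`: `a + b = 0 ↔ a = b` (characteristic two). [folklore] -/
@[simp] theorem wreathF2V_add_eq_zero (a b : wreathF2V) : a + b = 0 ↔ a = b :=
  CharTwo.add_eq_zero

/-- Two elements of `H = V³` agree iff they agree at the coordinates `0, 1, 2`. [folklore] -/
theorem wreathF2_funext3 {x y : wreathF2H} : x = y ↔ x 0 = y 0 ∧ x 1 = y 1 ∧ x 2 = y 2 :=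
  ⟨fun h => h ▸ ⟨rfl, rfl, rfl⟩,
    fun ⟨h0, h1, h2⟩ => funext fun i => match i with | 0 => h0 | 1 => h1 | 2 => h2⟩

/-- `Fintype.card V = 16`. [folklore] -/
theorem wreathF2V_card : Fintype.card wreathF2V = 16 := by
  simp only [Fintype.card_fun, ZMod.card, Fintype.card_fin, Nat.reducePow]

/-- `Fintype.card H = 2¹²`. [folklore] -/
theorem wreathF2H_card : Fintype.card wreathF2H = 4096 := by
  simp only [Fintype.card_fun, ZMod.card, Fintype.card_fin, Nat.reducePow]

/-- In `ZMod 2`: `f + f' = 0 ↔ f = f'`. [folklore] -/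
@[simp] theorem wreathF2Z_add_eq_zero (f f' : ZMod 2) : f + f' = 0 ↔ f = f' :=
  CharTwo.add_eq_zero

/-- The action of `C₂ = ZMod 2` on `E = H × H`: `0` acts trivially, `1` swaps the two copies of `H`. -/
def wreathF2act (f : ZMod 2) (e : wreathF2E) : wreathF2E := if f = 0 then e else e.swap

/-- `0` acts trivially. [folklore] -/
@[simp] theorem wreathF2act_zero (e : wreathF2E) : wreathF2act 0 e = e := by simp [wreathF2act]

/-- `1` acts by the swap. [folklore] -/
@[simp] theorem wreathF2act_one (e : wreathF2E) : wreathF2act 1 e = e.swap := by simp [wreathF2act]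

/-- The swap action is an action of the additive group `ZMod 2`. [folklore] -/
theorem wreathF2act_add (f f' : ZMod 2) (e : wreathF2E) :
    wreathF2act (f + f') e = wreathF2act f (wreathF2act f' e) := by
  rcases wreathF2_zmod2 f with rfl | rfl <;> rcases wreathF2_zmod2 f' with rfl | rfl <;> simp

/-- The swap action is by additive maps. [folklore] -/
theorem wreathF2act_add' (f : ZMod 2) (u v : wreathF2E) :
    wreathF2act f (u + v) = wreathF2act f u + wreathF2act f v := by
  rcases wreathF2_zmod2 f with rfl | rfl <;> simp

/-- The swap action fixes `0`. [folklore] -/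
@[simp] theorem wreathF2act_zero' (f : ZMod 2) : wreathF2act f 0 = 0 := by
  rcases wreathF2_zmod2 f with rfl | rfl <;> simp

/-! ### The host `G = E ⋊ C₂ = H ≀ C₂` acting affinely on `X = E` -/

/-- The wreath product `H ≀ C₂ = (H × H) ⋊ C₂` (`H = 𝔽₂¹²`): pairs `(t, f)` of a translation `t ∈ E`
and a flag `f ∈ ZMod 2`, with `(t,f)(t',f') = (t + f·t', f + f')`. -/
@[ext] structure wreathF2G : Type where
  /-- the translation part, an element of `E = H × H` -/
  t : wreathF2E
  /-- the `C₂`-flag (`1` = swap the two copies of `H`) -/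
  f : ZMod 2
  deriving DecidableEq

namespace wreathF2G

/-- Multiplication of the semidirect product `E ⋊ C₂`. -/
instance instMul : Mul wreathF2G := ⟨fun g h => ⟨g.t + wreathF2act g.f h.t, g.f + h.f⟩⟩

/-- Unit of `E ⋊ C₂`. -/
instance instOne : One wreathF2G := ⟨⟨0, 0⟩⟩

/-- Inversion in `E ⋊ C₂` (characteristic two: `-x = x`). -/
instance instInv : Inv wreathF2G := ⟨fun g => ⟨wreathF2act g.f g.t, g.f⟩⟩

/-- Translation part of a product. [folklore] -/
@[simp] theorem mul_t (g h : wreathF2G) : (g * h).t = g.t + wreathF2act g.f h.t := rfl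

/-- Flag of a product. [folklore] -/
@[simp] theorem mul_f (g h : wreathF2G) : (g * h).f = g.f + h.f := rfl

/-- Translation part of `1`. [folklore] -/
@[simp] theorem one_t : (1 : wreathF2G).t = 0 := rfl

/-- Flag of `1`. [folklore] -/
@[simp] theorem one_f : (1 : wreathF2G).f = 0 := rfl

/-- Translation part of an inverse. [folklore] -/
@[simp] theorem inv_t (g : wreathF2G) : g⁻¹.t = wreathF2act g.f g.t := rfl

/-- Flag of an inverse. [folklore] -/
@[simp] theorem inv_f (g : wreathF2G) : g⁻¹.f = g.f := rfl

/-- `E ⋊ C₂` is a group. -/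
instance instGroup : Group wreathF2G where
  mul_assoc a b c := by ext <;> simp [wreathF2act_add, wreathF2act_add', add_assoc]
  one_mul a := by ext <;> simp
  mul_one a := by ext <;> simp
  inv_mul_cancel a := by ext <;> simp [CharTwo.add_self_eq_zero]

/-- The affine action of `E ⋊ C₂` on `X = E`: `(t, f) • x = t + f·x`. -/
instance instMulAction : MulAction wreathF2G wreathF2E where
  smul g x := g.t + wreathF2act g.f x
  one_smul x := by
    show (1 : wreathF2G).t + wreathF2act (1 : wreathF2G).f x = x
    simp
  mul_smul g h x := by
    show (g * h).t + wreathF2act (g * h).f x = g.t + wreathF2act g.f (h.t + wreathF2act h.f x)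
    simp [wreathF2act_add, wreathF2act_add', add_assoc]

/-- Unfolding the action. [folklore] -/
@[simp] theorem smul_def (g : wreathF2G) (x : wreathF2E) : g • x = g.t + wreathF2act g.f x := rfl

/-- `E ⋊ C₂ ≃ E × C₂` as sets. -/
def equivProd : wreathF2E × ZMod 2 ≃ wreathF2G where
  toFun p := ⟨p.1, p.2⟩
  invFun g := (g.t, g.f)
  left_inv _ := rfl
  right_inv _ := rfl

/-- `E ⋊ C₂` is finite. -/
instance instFintype : Fintype wreathF2G := Fintype.ofEquiv _ equivProd

end wreathF2G

/-- `|G| = 2 · 2²⁴ = 2²⁵ = 33554432`. [folklore] -/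
theorem wreathF2_card : Fintype.card wreathF2G = 33554432 := by
  simp only [← Fintype.card_congr wreathF2G.equivProd, Fintype.card_prod, ZMod.card,
    wreathF2H_card, Nat.reduceMul]

/-- Generous transitivity of the affine host: `g = (x + y, 0)` swaps `x` and `y` (characteristic two).
[folklore] -/
theorem wreathF2_gt (x y : wreathF2E) : ∃ g : wreathF2G, g • x = y ∧ g • y = x := by
  refine ⟨⟨x + y, 0⟩, ?_, ?_⟩
  · show x + y + wreathF2act 0 x = y
    rw [wreathF2act_zero, add_comm x y]
    exact CharTwo.add_cancel_right y x
  · show x + y + wreathF2act 0 y = x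
    rw [wreathF2act_zero]
    exact CharTwo.add_cancel_right x y

/-! ### The triple `S, T, U` -/

/-- `m₀(a,b,f) = ((a e₀, b e₁), f)`. -/
def wreathF2m0 : wreathF2V × wreathF2V × ZMod 2 → wreathF2G
  | (a, b, f) => ⟨(Pi.single 0 a, Pi.single 1 b), f⟩

/-- `m₁(a,b,f) = ((a e₁, b e₂), f)`. -/
def wreathF2m1 : wreathF2V × wreathF2V × ZMod 2 → wreathF2G
  | (a, b, f) => ⟨(Pi.single 1 a, Pi.single 2 b), f⟩

/-- `m₂(a,b,f) = ((a e₂, b e₀), f)`. -/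
def wreathF2m2 : wreathF2V × wreathF2V × ZMod 2 → wreathF2G
  | (a, b, f) => ⟨(Pi.single 2 a, Pi.single 0 b), f⟩

/-- The common parameter domain `(V ∖ 0) × V × C₂` of the three legs. -/
def wreathF2D : Finset (wreathF2V × wreathF2V × ZMod 2) :=
  ((Finset.univ : Finset wreathF2V).filter (· ≠ 0)) ×ˢ (Finset.univ : Finset wreathF2V) ×ˢ
    (Finset.univ : Finset (ZMod 2))

/-- `S = m₀((V ∖ 0) × V × C₂)`. -/
def wreathF2S : Finset wreathF2G := wreathF2D.image wreathF2m0

/-- `T = m₁((V ∖ 0) × V × C₂)`. -/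
def wreathF2T : Finset wreathF2G := wreathF2D.image wreathF2m1

/-- `U = m₂((V ∖ 0) × V × C₂)`. -/
def wreathF2U : Finset wreathF2G := wreathF2D.image wreathF2m2

/-- `U • 0 = {(a e₂, b e₀) : a ≠ 0}` as an explicit image. -/
def wreathF2P : Finset wreathF2E :=
  (((Finset.univ : Finset wreathF2V).filter (· ≠ 0)) ×ˢ (Finset.univ : Finset wreathF2V)).image
    fun q => ((Pi.single 2 q.1, Pi.single 0 q.2) : wreathF2E)

/-- Membership in the parameter domain. [folklore] -/
theorem wreathF2_mem_D {p : wreathF2V × wreathF2V × ZMod 2} : p ∈ wreathF2D ↔ p.1 ≠ 0 := by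
  simp [wreathF2D]

/-- `|(V ∖ 0) × V × C₂| = 15 · 16 · 2 = 480`. [folklore] -/
theorem wreathF2D_card : wreathF2D.card = 480 := by
  rw [wreathF2D, Finset.card_product, Finset.card_product, Finset.filter_ne',
    Finset.card_erase_of_mem (Finset.mem_univ _)]
  simp only [Finset.card_univ, wreathF2V_card, ZMod.card, Nat.reduceSub, Nat.reduceMul]

/-- `m₀` and `m₁` are injective. [folklore] -/
theorem wreathF2m_injective : Function.Injective wreathF2m0 ∧ Function.Injective wreathF2m1 := by
  constructor <;> rintro ⟨a, b, f⟩ ⟨a', b', f'⟩ h <;>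
    simpa [wreathF2m0, wreathF2m1, and_assoc] using h

/-- `|S| = 480`. [folklore] -/
theorem wreathF2S_card : wreathF2S.card = 480 := by
  rw [wreathF2S, Finset.card_image_of_injective _ wreathF2m_injective.1, wreathF2D_card]

/-- `|T| = 480`. [folklore] -/
theorem wreathF2T_card : wreathF2T.card = 480 := by
  rw [wreathF2T, Finset.card_image_of_injective _ wreathF2m_injective.2, wreathF2D_card]

/-- The orbit piece `U • 0` is `{(a e₂, b e₀) : a ≠ 0}`. [folklore] -/
theorem wreathF2U_image : wreathF2U.image (fun u => u • (0 : wreathF2E)) = wreathF2P := by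
  ext x
  simp only [wreathF2U, wreathF2P, Finset.mem_image, wreathF2_mem_D, Finset.mem_product,
    Finset.mem_filter, Finset.mem_univ, true_and, and_true, Prod.exists, wreathF2G.smul_def,
    wreathF2act_zero', add_zero]
  constructor
  · rintro ⟨_, ⟨a, b, f, ha, rfl⟩, rfl⟩
    exact ⟨a, b, ha, rfl⟩
  · rintro ⟨a, b, ha, rfl⟩
    exact ⟨_, ⟨a, b, 0, ha, rfl⟩, rfl⟩

/-- `|U • 0| = 15 · 16 = 240`. [folklore] -/
theorem wreathF2_orbit_card : (wreathF2U.image fun u => u • (0 : wreathF2E)).card = 240 := by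
  have hinj : Function.Injective
      fun q : wreathF2V × wreathF2V => ((Pi.single 2 q.1, Pi.single 0 q.2) : wreathF2E) := by
    rintro ⟨a, b⟩ ⟨a', b'⟩ h
    simpa using h
  rw [wreathF2U_image, wreathF2P, Finset.card_image_of_injective _ hinj, Finset.card_product,
    Finset.filter_ne', Finset.card_erase_of_mem (Finset.mem_univ _)]
  simp only [Finset.card_univ, wreathF2V_card, Nat.reduceSub, Nat.reduceMul]

/-- Capacity of the triple: `|S| · |T| · |U • 0| = 480 · 480 · 240 = 55296000`. [folklore] -/
theorem wreathF2_abc :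
    wreathF2S.card * wreathF2T.card * (wreathF2U.image fun u => u • (0 : wreathF2E)).card
      = 55296000 := by
  rw [wreathF2S_card, wreathF2T_card, wreathF2_orbit_card]

/-- Saturation: `U · G_{0} = U` (the stabiliser of `0` is the flag group `C₂`). [folklore] -/
theorem wreathF2_sat :
    ∀ u ∈ wreathF2U, ∀ h : wreathF2G, h • (0 : wreathF2E) = 0 → u * h ∈ wreathF2U := by
  intro u hu h hh
  rw [wreathF2G.smul_def, wreathF2act_zero', add_zero] at hh
  simp only [wreathF2U, Finset.mem_image, wreathF2_mem_D, Prod.exists] at hu ⊢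
  obtain ⟨a, b, f, ha, rfl⟩ := hu
  exact ⟨a, b, f + h.f, ha, by ext <;> simp [wreathF2m2, hh]⟩

/-- Product of three elements of `E ⋊ C₂` in coordinates. [folklore] -/
theorem wreathF2_mul3 (t₁ t₂ t₃ : wreathF2E) (φ₁ φ₂ φ₃ : ZMod 2) :
    (⟨t₁, φ₁⟩ * ⟨t₂, φ₂⟩ * ⟨t₃, φ₃⟩ : wreathF2G) =
      ⟨t₁ + wreathF2act φ₁ t₂ + wreathF2act (φ₁ + φ₂) t₃, φ₁ + φ₂ + φ₃⟩ := rfl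

/-- A quotient `(e,f) (e',f')⁻¹ = (e + (f+f')·e', f + f')` in `E ⋊ C₂` (characteristic two).
[folklore] -/
theorem wreathF2_quot (e e' : wreathF2E) (f f' : ZMod 2) :
    (⟨e, f⟩ * ⟨e', f'⟩⁻¹ : wreathF2G) = ⟨e + wreathF2act (f + f') e', f + f'⟩ := by
  ext <;> simp [wreathF2act_add]

/-- **Triple product property** of `(S, T, U)` in `H ≀ C₂` (Cohn–Kleinberg–Szegedy–Umans parity
argument): if `s s'⁻¹ · t t'⁻¹ · u u'⁻¹ = 1` then, writing the three quotients as
`(eᵢ + φᵢ·eᵢ', φᵢ)`, the flags force `φ₁ + φ₂ + φ₃ = 0`, i.e. an even number of swaps; with no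
swap the coordinates `0,1,2` of both copies of `H` separate the three legs, and in each of the three
two-swap patterns one of the non-zero parameters `a₁, a₂, a₃` is isolated in a single coordinate,
a contradiction. [cite: CohnKleinbergSzegedyUmans2005, §2 Lemma 2.1 (= arXiv:math/0511460 Lemma 10)] -/
theorem wreathF2_tpp :
    ∀ s ∈ wreathF2S, ∀ s' ∈ wreathF2S, ∀ t ∈ wreathF2T, ∀ t' ∈ wreathF2T,
      ∀ u ∈ wreathF2U, ∀ u' ∈ wreathF2U,
        s * s'⁻¹ * (t * t'⁻¹) * (u * u'⁻¹) = 1 → s = s' ∧ t = t' ∧ u = u' := by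
  intro s hs s' hs' t ht t' ht' u hu u' hu' h
  simp only [wreathF2S, wreathF2T, wreathF2U, Finset.mem_image, wreathF2_mem_D, Prod.exists]
    at hs hs' ht ht' hu hu'
  obtain ⟨a₁, b₁, f₁, ha₁, rfl⟩ := hs
  obtain ⟨a₁', b₁', f₁', -, rfl⟩ := hs'
  obtain ⟨a₂, b₂, f₂, ha₂, rfl⟩ := ht
  obtain ⟨a₂', b₂', f₂', -, rfl⟩ := ht'
  obtain ⟨a₃, b₃, f₃, ha₃, rfl⟩ := hu
  obtain ⟨a₃', b₃', f₃', -, rfl⟩ := hu'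
  simp only [wreathF2m0, wreathF2m1, wreathF2m2, wreathF2_quot, wreathF2_mul3] at h
  generalize hφ₁ : f₁ + f₁' = φ₁ at h
  generalize hφ₂ : f₂ + f₂' = φ₂ at h
  generalize hφ₃ : f₃ + f₃' = φ₃ at h
  have hf := congrArg wreathF2G.f h
  have ht := congrArg wreathF2G.t h
  -- the eight flag patterns: odd ones contradict `hf`, two-swap ones isolate some `aᵢ = 0`
  rcases wreathF2_zmod2 φ₁ with rfl | rfl <;> rcases wreathF2_zmod2 φ₂ with rfl | rfl <;>
    rcases wreathF2_zmod2 φ₃ with rfl | rfl <;>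
    simp only [add_zero, zero_add, wreathF2_one_add_one, one_ne_zero, wreathF2G.one_f] at hf <;>
    simp [wreathF2_funext3, and_assoc, ha₁, ha₂, ha₃] at ht hφ₁ hφ₂ hφ₃
  -- no swap: all parameters agree
  obtain ⟨rfl, rfl, rfl, rfl, rfl, rfl⟩ := ht
  obtain rfl := hφ₁; obtain rfl := hφ₂; obtain rfl := hφ₃
  exact ⟨rfl, rfl, rfl⟩

/-! ### Cost and the calibration -/

/-- The calibration inequality `2²⁵ = 33554432 ≤ 55296000^{(2+ε)/3}` for `ε ≥ 11/12`
(`(2+ε)/3 ≥ 35/36` and `33554432³⁶ ≤ 55296000³⁵`). [folklore] -/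
theorem wreathF2_numeric (ε : ℝ) (hε : 11 / 12 ≤ ε) :
    (33554432 : ℝ) ≤ (55296000 : ℝ) ^ ((2 + ε) / 3) := by
  have h1 : (1 : ℝ) ≤ 55296000 := by norm_num
  have h2 : (35 : ℝ) / 36 ≤ (2 + ε) / 3 := by linarith
  refine le_trans ?_ (Real.rpow_le_rpow_of_exponent_le h1 h2)
  have h3 : (33554432 : ℝ) ^ (36 : ℕ) ≤ ((55296000 : ℝ) ^ ((35 : ℝ) / 36)) ^ (36 : ℕ) := by
    rw [← Real.rpow_mul_natCast (by norm_num : (0 : ℝ) ≤ 55296000)]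
    norm_num
  exact le_of_pow_le_pow_left₀ (by norm_num) (by positivity) h3

/-- **The saturated CKSU triple in the generously transitive host `H ≀ C₂ ↷ H × H` (`H = 𝔽₂¹²`).**
There are a finite group `G` (order `2²⁵ = 33554432`), a finite `G`-set `X` with base point `x₀` and
`S, T, U ⊆ G` such that the action is generously transitive, `(S,T,U)` has the triple product
property, `U · G_{x₀} = U`, and `|S| · |T| · |U • x₀| = 480 · 480 · 240 = 55296000`.
[cite: CohnKleinbergSzegedyUmans2005, §2 Lemma 2.1 (= arXiv:math/0511460 Lemma 10)] -/
theorem wreathF2_saturatedTriple :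
    ∃ (G : Type) (_ : Group G) (_ : Fintype G) (X : Type) (_ : Fintype X) (_ : DecidableEq X)
      (_ : MulAction G X) (x₀ : X) (S T U : Finset G),
      (∀ x y : X, ∃ g : G, g • x = y ∧ g • y = x) ∧
      (∀ s ∈ S, ∀ s' ∈ S, ∀ t ∈ T, ∀ t' ∈ T, ∀ u ∈ U, ∀ u' ∈ U,
        s * s'⁻¹ * (t * t'⁻¹) * (u * u'⁻¹) = 1 → s = s' ∧ t = t' ∧ u = u') ∧
      (∀ u ∈ U, ∀ h : G, h • x₀ = x₀ → u * h ∈ U) ∧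
      S.card * T.card * (U.image fun u => u • x₀).card = 55296000 ∧
      Fintype.card G = 33554432 :=
  -- The instance witnesses are the literal instance terms (the `DecidableEq` one is copied from the
  -- statement of `wreathF2_abc` by unification), so that every conjunct is *syntactically* the
  -- statement of the corresponding lemma: a merely defeq variant under `_ * _ * _` makes the
  -- kernel's `Nat.mul` reduction try to evaluate `|S|` by brute force.
  ⟨wreathF2G, wreathF2G.instGroup, wreathF2G.instFintype, wreathF2E, inferInstance, _,
    wreathF2G.instMulAction, 0, wreathF2S, wreathF2T, wreathF2U, wreathF2_gt, wreathF2_tpp,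
    wreathF2_sat, wreathF2_abc, wreathF2_card⟩

/-- **Calibration of `stub_saturatedTripleHosts`.** The `∃`-body of the registered stub holds
verbatim for every `ε ≥ 11/12`: the wreath triple has `2 ≤ |S||T||U•x₀| = 55296000` and host cost
`D = dim span{P_g} ≤ |G| = 2²⁵ ≤ 55296000^{(2+ε)/3}`.  (So the content of the stub — and of the crux —
lies entirely in the range `ε < 11/12`.) [cite: CohnKleinbergSzegedyUmans2005, §2 Lemma 2.1 (= arXiv:math/0511460 Lemma 10)] -/
theorem wreathF2_stubBody_of_ge (ε : ℝ) (hε : 11 / 12 ≤ ε) :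
    ∃ (G : Type) (_ : Group G) (_ : Fintype G) (X : Type) (_ : Fintype X) (_ : DecidableEq X) (_ : MulAction G X) (x₀ : X) (S T U : Finset G), (∀ x y : X, ∃ g : G, g • x = y ∧ g • y = x) ∧ (∀ s ∈ S, ∀ s' ∈ S, ∀ t ∈ T, ∀ t' ∈ T, ∀ u ∈ U, ∀ u' ∈ U, s * s'⁻¹ * (t * t'⁻¹) * (u * u'⁻¹) = 1 → s = s' ∧ t = t' ∧ u = u') ∧ (∀ u ∈ U, ∀ h : G, h • x₀ = x₀ → u * h ∈ U) ∧ 2 ≤ S.card * T.card * (U.image fun u => u • x₀).card ∧ (Module.finrank ℂ (Submodule.span ℂ (Set.range fun g : G => Matrix.of fun y x : X => if g • x = y then (1 : ℂ) else 0)) : ℝ) ≤ ((S.card * T.card * (U.image fun u => u • x₀).card : ℕ) : ℝ) ^ ((2 + ε) / 3) := by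
  obtain ⟨G, iG, iF, X, iFX, iDX, iMA, x₀, S, T, U, hgt, htpp, hsat, habc, hcard⟩ :=
    wreathF2_saturatedTriple
  refine ⟨G, iG, iF, X, iFX, iDX, iMA, x₀, S, T, U, hgt, htpp, hsat, by rw [habc]; norm_num, ?_⟩
  have hD : Module.finrank ℂ (Submodule.span ℂ (Set.range fun g : G =>
      Matrix.of fun y x : X => if g • x = y then (1 : ℂ) else 0)) ≤ 33554432 :=
    (finrank_range_le_card (R := ℂ) _).trans hcard.le
  rw [habc, Nat.cast_ofNat]
  exact le_trans (by exact_mod_cast hD) (wreathF2_numeric ε hε)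

/-- **A module host beats the sum of the squares** (the `∃`-shape consumed by stubs 1–2 of the line to
give `BeatTheSquares`): in the generously transitive host `H ≀ C₂ ↷ H × H`, `H = 𝔽₂¹²`, the saturated
TPP triple has `|S| · |T| · |U • x₀| = 55296000 > 2²⁵ = |G| ≥ dim span{P_g}`.
[cite: CohnKleinbergSzegedyUmans2005, §2 Lemma 2.1 (= arXiv:math/0511460 Lemma 10)] -/
theorem wreathF2_beats :
    ∃ (G : Type) (_ : Group G) (_ : Fintype G) (X : Type) (_ : Fintype X) (_ : DecidableEq X)
      (_ : MulAction G X) (x₀ : X) (S T U : Finset G),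
      (∀ x y : X, ∃ g : G, g • x = y ∧ g • y = x) ∧
      (∀ s ∈ S, ∀ s' ∈ S, ∀ t ∈ T, ∀ t' ∈ T, ∀ u ∈ U, ∀ u' ∈ U,
        s * s'⁻¹ * (t * t'⁻¹) * (u * u'⁻¹) = 1 → s = s' ∧ t = t' ∧ u = u') ∧
      (∀ u ∈ U, ∀ h : G, h • x₀ = x₀ → u * h ∈ U) ∧
      Module.finrank ℂ (Submodule.span ℂ (Set.range fun g : G => Matrix.of fun y x : X =>
        if g • x = y then (1 : ℂ) else 0)) < S.card * T.card * (U.image fun u => u • x₀).card := by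
  obtain ⟨G, iG, iF, X, iFX, iDX, iMA, x₀, S, T, U, hgt, htpp, hsat, habc, hcard⟩ :=
    wreathF2_saturatedTriple
  refine ⟨G, iG, iF, X, iFX, iDX, iMA, x₀, S, T, U, hgt, htpp, hsat, ?_⟩
  rw [habc]
  exact ((finrank_range_le_card (R := ℂ) _).trans hcard.le).trans_lt (by norm_num)

end Summit.MatrixMultiplication.MatrixMultiplication.Theorems.GelfandHosting.Negative
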